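import Summits.Langlands.Langlands.Theses.TorsionKudlaMillsonWindow

/-!
# Negative lemma for `TorsionKudlaMillsonWindow.ThetaInertAnnihilation` (stmt-Langlands-13530)

`ThetaInertAnnihilation` is FALSE AS TYPED modulo the hypothesis `H = ExistsNonvanishingCodifferentInstance`
(refuter route-review gen 3, concurring with refuter-rattack-stmt-Langlands-13530-0 and the gen-2 review):
the conclusion quantifies over all totally positive `T : Matrix (Fin 2) (Fin 2) F`, but `heckeT` lives on
`qIndexSet F` (entries in the inverse different), while `IsTheta c f` pins `f` to `0` at every totally
positive matrix with a NON-integral entry (no admissible frame: inner products of integral quaternions are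
integral).  At a totally positive inert prime `ϖ` whose inverse lies in the codifferent
(`Tr_{F/ℚ}(ϖ⁻¹ 𝓞 F) ⊆ ℤ`, e.g. `F = ℚ(√5)`, `ϖ = (5+√5)/2`), the matrix `T := ϖ⁻¹ • S` is in `qIndexSet F`
for every integral `S ≫ 0`, and when `ϖ² ∤ det S` all the twisted arguments of the Hecke formula have
non-integral determinant, so the filed identity collapses to `f S = 0` for both signs `e`.  Hence the crux
forces every twisted class-number series of this sub-family to be supported on `{ϖ² ∣ det S}`; `H` says that
this is not so (some instance has `f S ≠ 0`), which is the route's own non-vanishing expectation but needs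
the unit group of a quaternion order over a quartic field to certify — not constructible in the tree today.

Repair (planner): restrict the conclusion to integral `T` (see evidence `Repair13530.lean`,
`ThetaInertAnnihilationIntegral`), after which the statement is a `c`-independent lattice identity.
-/

namespace Summit.Langlands.Langlands.Theorems.ThetaInertAnnihilation.Negative

open scoped BigOperators Matrix
open Summit.Langlands.Langlands.Theses.TorsionKudlaMillsonWindow
open Literature.NumberTheory.Automorphic Literature.NumberTheory.Automorphic.HilbertSiegel

/-- The crux `ThetaInertAnnihilation` with its conclusion abstracted into a predicate `P` of the base
field, the coefficient ring, the coefficient function `f` (constrained by `IsTheta c f`) and the inert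
prime `ϖ`; `ThetaInertAnnihilation` is literally `ThetaInertShape (fun F _ _ A _ f ϖ => ∃ e, …)`
(`thetaInertAnnihilation_iff_shape`). [folklore] -/
def ThetaInertShape (P : ∀ (F : Type) [Field F] [NumberField F] (A : Type) [CommRing A],
    (Matrix (Fin 2) (Fin 2) F → A) → NumberField.RingOfIntegers F → Prop) : Prop :=
  ∀ (F K : Type) [Field F] [NumberField F] [Field K] [NumberField K] [Algebra F K] (σ : K ≃ₐ[F] K) (a b : NumberField.RingOfIntegers F), NumberField.IsTotallyReal F → Module.finrank F K = 2 → σ ≠ 1 → NumberField.InfinitePlace.nrComplexPlaces K = 1 → a ≠ 0 → b ≠ 0 → (∀ φ : K →+* ℂ, (starRingEnd ℂ).comp φ = φ → (φ (algebraMap F K a)).re < 0 ∧ (φ (algebraMap F K b)).re < 0) → (∀ φ : K →+* ℂ, (starRingEnd ℂ).comp φ ≠ φ → 0 < (φ (algebraMap F K a)).re ∨ 0 < (φ (algebraMap F K b)).re) → let a' : K := algebraMap F K a; let b' : K := algebraMap F K b; (∀ y : QuaternionAlgebra K a' 0 b', y * star y = 0 → y = 0) → let IsInt : QuaternionAlgebra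 K a' 0 b' → Prop := fun x => ∀ i : Fin 4, QuaternionAlgebra.equivTuple a' 0 b' x i ∈ Set.range (algebraMap (NumberField.RingOfIntegers K) K); let IsG : (QuaternionAlgebra K a' 0 b')ˣ → Prop := fun u => IsInt (u : QuaternionAlgebra K a' 0 b') ∧ IsInt ((u⁻¹ : (QuaternionAlgebra K a' 0 b')ˣ) : QuaternionAlgebra K a' 0 b'); ∀ (δ : K) (φ₀ : K →+* ℂ), σ δ = -δ → δ ≠ 0 → (starRingEnd ℂ).comp φ₀ ≠ φ₀ → let sB : QuaternionAlgebra K a' 0 b' → QuaternionAlgebra K a' 0 b' := fun y => ⟨σ y.re, σ y.imI, σ y.imJ, σ y.imK⟩; let V : QuaternionAlgebra K a' 0 b' → Prop := fun y => sB y = star y; let ip : QuaternionAlgebra K a' 0 b' → QuaternionAlgebra K a' 0 b' → K := fun y z => (y * star z).re; let act : QuaternionAlgebra K a' 0 b' → QuaternionAlgebra K a' 0 b' → QuaternionAlgebra K a' 0 b' := fun g y => g * y * sB (star g); let G1 : (QuaternionAlgebra K a' 0 b')ˣ → Prop := fun u => IsG u ∧ (u : QuaternionAlgebra K a' 0 b')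 * star (u : QuaternionAlgebra K a' 0 b') = 1; let Stab : (Fin 2 → QuaternionAlgebra K a' 0 b') → (QuaternionAlgebra K a' 0 b')ˣ → Prop := fun x γ => G1 γ ∧ ∀ i, act γ (x i) = x i; let Pos : (Fin 2 → QuaternionAlgebra K a' 0 b') → (QuaternionAlgebra K a' 0 b')ˣ → Prop := fun x γ => ∃ y z, V y ∧ V z ∧ 0 < (φ₀ ((Matrix.of ![QuaternionAlgebra.equivTuple a' 0 b' (x 0), QuaternionAlgebra.equivTuple a' 0 b' (x 1), QuaternionAlgebra.equivTuple a' 0 b' y, QuaternionAlgebra.equivTuple a' 0 b' z]).det * δ * (ip y (act γ z) - ip y (act ((γ⁻¹ : (QuaternionAlgebra K a' 0 b')ˣ) : QuaternionAlgebra K a' 0 b') z)))).re; let Gen : (Fin 2 → QuaternionAlgebra K a' 0 b') → (QuaternionAlgebra K a' 0 b')ˣ → Prop := fun x γ => Stab x γ ∧ Pos x γ ∧ ∀ γ', Stab x γ' → ∃ (n : ℤ) (ζ : (QuaternionAlgebra K a' 0 b')ˣ), IsOfFinOrder ζ ∧ γ' = ζ * γ ^ n; let Adm : Matrix (Fin 2)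 (Fin 2) F → (Fin 2 → QuaternionAlgebra K a' 0 b') → Prop := fun T x => (∀ i, V (x i) ∧ IsInt (x i)) ∧ ∀ i j, ip (x i) (x j) = algebraMap F K (T i j); ∀ (A : Type) [CommRing A] [Finite A], let IsTheta : ((QuaternionAlgebra K a' 0 b')ˣ → A) → (Matrix (Fin 2) (Fin 2) F → A) → Prop := fun c f => ∀ T : Matrix (Fin 2) (Fin 2) F, (∀ τ : F →+* ℝ, (T.map τ).PosDef) → ∀ (m : ℕ) (x : Fin m → Fin 2 → QuaternionAlgebra K a' 0 b'), (∀ k, Adm T (x k)) → (∀ x', Adm T x' → ∃! k, ∃ g, G1 g ∧ ∀ i, act g (x' i) = x k i) → ∀ γ : Fin m → (QuaternionAlgebra K a' 0 b')ˣ, (∀ k, Gen (x k) (γ k)) → f T = ∑ k, c (γ k); ∀ (c : (QuaternionAlgebra K a' 0 b')ˣ → A), (∀ x y, IsG x → IsG y → c (x * y) = c x + c y) → (∀ u, IsG u → (u : QuaternionAlgebra K a' 0 b') ∈ Set.range (algebraMap K (QuaternionAlgebra K a' 0 b')) → c u = 0) → ∀ f : Matrix (Fin 2) (Fin 2) F →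 A, IsTheta c f → ∀ ϖ : NumberField.RingOfIntegers F, Prime ϖ → (∀ τ : F →+* ℝ, 0 < τ ϖ) → Prime (algebraMap (NumberField.RingOfIntegers F) (NumberField.RingOfIntegers K) ϖ) → (2 * a * b * (Nat.card A : NumberField.RingOfIntegers F)) ∉ Ideal.span {ϖ} → P F A f ϖ

/-- The filed crux is the shape at its own conclusion. [folklore] -/
theorem thetaInertAnnihilation_iff_shape :
    ThetaInertAnnihilation ↔ ThetaInertShape (fun F _ _ A _ f ϖ => ∃ e : ℤ, (e = 1 ∨ e = -1) ∧
      ∀ T : Matrix (Fin 2) (Fin 2) F, (∀ τ : F →+* ℝ, (T.map τ).PosDef) →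
        Literature.NumberTheory.Automorphic.HilbertSiegel.heckeT ϖ 2 (e : A) f T = 0) :=
  Iff.rfl

/-- **H** (`ExistsNonvanishingCodifferentInstance`): it is NOT the case that, for every admissible
instance of the crux's hypotheses in which the inert prime `ϖ` has its inverse in the codifferent
(`∀ x : 𝓞 F, Tr_{F/ℚ}(ϖ⁻¹ x) ∈ ℤ`), the theta coefficient function `f` vanishes at every symmetric integral
totally positive `S` with `ϖ² ∤ det S`.  Equivalently (classically): some twisted class-number series of an
F-trace-geodesic lattice over the quadratic window, at a totally positive inert prime dividing the different,
has a non-zero coefficient at a `ϖ²`-coprime discriminant — the route's own non-vanishing expectation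
(engine (ii) of `ThetaEngineCompletion`); certifying it needs the unit group of a quaternion order over a
quartic field (e.g. `ℚ(√5, √−ε)`), not constructible in the tree today.
[topic Literature/NumberTheory/Automorphic — theta series of quaternary lattices] -/
def ExistsNonvanishingCodifferentInstance : Prop :=
  ¬ ThetaInertShape (fun F _ _ _A _ f ϖ =>
      (∀ x : NumberField.RingOfIntegers F, ∃ n : ℤ, Algebra.trace ℚ F ((ϖ : F)⁻¹ * (x : F)) = n) →
      ∀ S : Matrix (Fin 2) (Fin 2) (NumberField.RingOfIntegers F), S.IsSymm →
        (∀ τ : F →+* ℝ, ((S.map (algebraMap (NumberField.RingOfIntegers F) F)).map τ).PosDef) →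
        ¬ (ϖ ^ 2 ∣ S.det) → f (S.map (algebraMap (NumberField.RingOfIntegers F) F)) = 0)


/-! ## Auxiliary lemmas -/

section Aux

open NumberField

/-- An element of `F` whose image in `K` is an algebraic integer is an algebraic integer. [folklore] -/
theorem mem_range_ringOfIntegers_of_algebraMap {F K : Type} [Field F] [Field K] [Algebra F K] {x : F}
    (h : algebraMap F K x ∈ Set.range (algebraMap (𝓞 K) K)) :
    x ∈ Set.range (algebraMap (𝓞 F) F) := by
  obtain ⟨r, hr⟩ := h
  have hK : IsIntegral ℤ (algebraMap F K x) := hr ▸ RingOfIntegers.isIntegral_coe r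
  have hF : IsIntegral ℤ x :=
    (isIntegral_algHom_iff (algebraMap F K).toIntAlgHom (algebraMap F K).injective).mp hK
  exact ⟨⟨x, hF⟩, rfl⟩

/-- Reduced-trace part of `y * star z` for quaternions with algebraic-integer coordinates over
algebraic-integer parameters `(a', 0, b')` is an algebraic integer. [folklore] -/
theorem re_mul_star_mem_range {K : Type} [Field K] {a' b' : K}
    (ha : a' ∈ Set.range (algebraMap (𝓞 K) K)) (hb : b' ∈ Set.range (algebraMap (𝓞 K) K))
    {y z : QuaternionAlgebra K a' 0 b'}
    (hy : ∀ i : Fin 4, QuaternionAlgebra.equivTuple a' 0 b' y i ∈ Set.range (algebraMap (𝓞 K) K))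
    (hz : ∀ i : Fin 4, QuaternionAlgebra.equivTuple a' 0 b' z i ∈ Set.range (algebraMap (𝓞 K) K)) :
    (y * star z).re ∈ Set.range (algebraMap (𝓞 K) K) := by
  obtain ⟨a₀, rfl⟩ := ha
  obtain ⟨b₀, rfl⟩ := hb
  obtain ⟨y₀, hy₀⟩ := hy 0
  obtain ⟨y₁, hy₁⟩ := hy 1
  obtain ⟨y₂, hy₂⟩ := hy 2
  obtain ⟨y₃, hy₃⟩ := hy 3
  obtain ⟨z₀, hz₀⟩ := hz 0
  obtain ⟨z₁, hz₁⟩ := hz 1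
  obtain ⟨z₂, hz₂⟩ := hz 2
  obtain ⟨z₃, hz₃⟩ := hz 3
  simp only [QuaternionAlgebra.equivTuple_apply, Matrix.cons_val_zero, Matrix.cons_val_one,
    Matrix.cons_val] at hy₀ hy₁ hy₂ hy₃ hz₀ hz₁ hz₂ hz₃
  refine ⟨y₀ * z₀ - a₀ * y₁ * z₁ - b₀ * y₂ * z₂ + a₀ * b₀ * y₃ * z₃, ?_⟩
  simp only [QuaternionAlgebra.re_mul, QuaternionAlgebra.re_star, QuaternionAlgebra.imI_star,
    QuaternionAlgebra.imJ_star, QuaternionAlgebra.imK_star, map_add, map_sub, map_mul,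
    hy₀, hy₁, hy₂, hy₃, hz₀, hz₁, hz₂, hz₃]
  ring

/-- Determinant of a matrix with algebraic-integer entries is an algebraic integer. [folklore] -/
theorem exists_det_eq_coe {F : Type} [Field F] {M : Matrix (Fin 2) (Fin 2) F}
    (hM : ∀ i j, M i j ∈ Set.range (algebraMap (𝓞 F) F)) : ∃ r : 𝓞 F, M.det = (r : F) := by
  choose M₀ hM₀ using hM
  refine ⟨(Matrix.of fun i j => M₀ i j).det, ?_⟩
  have : M = (Matrix.of fun i j => M₀ i j).map (algebraMap (𝓞 F) F) := by
    ext i j; simp [hM₀]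
  rw [this, RingOfIntegers.coe_eq_algebraMap (Matrix.of fun i j => M₀ i j).det, RingHom.map_det,
    RingHom.mapMatrix_apply]

/-- `(c • M).map τ = τ c • M.map τ` for a ring homomorphism `τ`. [folklore] -/
theorem map_smul_eq {F : Type} [Field F] (τ : F →+* ℝ) (c : F) (M : Matrix (Fin 2) (Fin 2) F) :
    (c • M).map τ = τ c • M.map τ := by
  ext i j; simp [Matrix.map_apply]

/-- Positivity transport: `τ(c • D T Dᵀ)` is positive definite when `τ(T)` is, `τ(det D) ≠ 0` and
`τ c > 0`. [folklore] -/
theorem posDef_twist {F : Type} [Field F] (τ : F →+* ℝ) {T : Matrix (Fin 2) (Fin 2) F}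
    (D : Matrix (Fin 2) (Fin 2) F) {c : F}
    (hT : (T.map τ).PosDef) (hD : τ D.det ≠ 0) (hc : 0 < τ c) :
    ((c • (D * T * Dᵀ)).map τ).PosDef := by
  rw [map_smul_eq]
  refine Matrix.PosDef.smul ?_ hc
  rw [Matrix.map_mul, Matrix.map_mul, Matrix.transpose_map,
    ← Matrix.conjTranspose_eq_transpose_of_trivial]
  refine hT.mul_mul_conjTranspose_same ?_
  refine Matrix.vecMul_injective_iff_isUnit.mpr ((Matrix.isUnit_iff_isUnit_det _).mpr ?_)
  rw [← RingHom.mapMatrix_apply, ← RingHom.map_det]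
  exact isUnit_iff_ne_zero.mpr hD

/-- Positivity transport for a positive scalar multiple. [folklore] -/
theorem posDef_smul_map {F : Type} [Field F] (τ : F →+* ℝ) {T : Matrix (Fin 2) (Fin 2) F} {c : F}
    (hT : (T.map τ).PosDef) (hc : 0 < τ c) : ((c • T).map τ).PosDef := by
  rw [map_smul_eq]
  exact hT.smul hc

/-- Determinant bookkeeping for the twisted matrices of the Hecke formula. [folklore] -/
theorem det_twist {F : Type} [Field F] (T D : Matrix (Fin 2) (Fin 2) F) (c : F) :
    (c • (D * T * Dᵀ)).det = c ^ 2 * D.det ^ 2 * T.det := by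
  rw [Matrix.det_smul, Matrix.det_mul, Matrix.det_mul, Matrix.det_transpose, Fintype.card_fin]; ring

/-- From `ϖ⁻² · s = r` in `F` with `ϖ, s, r` algebraic integers, `ϖ² ∣ s`. [folklore] -/
theorem sq_dvd_of_inv_sq_mul_eq {F : Type} [Field F] {ϖ s r : 𝓞 F} (hϖ : (ϖ : F) ≠ 0)
    (h : (ϖ : F)⁻¹ ^ 2 * (s : F) = r) : ϖ ^ 2 ∣ s := by
  have h' : (s : F) = (ϖ : F) ^ 2 * (r : F) := by
    rw [← h, ← mul_assoc, ← mul_pow, mul_inv_cancel₀ hϖ, one_pow, one_mul]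
  refine ⟨r, RingOfIntegers.coe_injective ?_⟩
  rw [map_mul, map_pow]
  exact h'

/-- From `ϖ⁻² · (ϖ⁻² · s) = r` in `F` with `ϖ, s, r` algebraic integers, `ϖ² ∣ s`. [folklore] -/
theorem sq_dvd_of_inv_sq_mul_inv_sq_mul_eq {F : Type} [Field F] {ϖ s r : 𝓞 F} (hϖ : (ϖ : F) ≠ 0)
    (h : (ϖ : F)⁻¹ ^ 2 * ((ϖ : F)⁻¹ ^ 2 * (s : F)) = r) : ϖ ^ 2 ∣ s := by
  have h1 : (ϖ : F)⁻¹ ^ 2 * (s : F) = (ϖ : F) ^ 2 * (r : F) := by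
    rw [← h, ← mul_assoc, ← mul_pow, mul_inv_cancel₀ hϖ, one_pow, one_mul]
  have h' : (s : F) = (ϖ : F) ^ 2 * ((ϖ : F) ^ 2 * (r : F)) := by
    rw [← h1, ← mul_assoc, ← mul_pow, mul_inv_cancel₀ hϖ, one_pow, one_mul]
  refine ⟨ϖ ^ 2 * r, RingOfIntegers.coe_injective ?_⟩
  rw [map_mul, map_pow, map_mul, map_pow]
  exact h'

end Aux

/-! ## The negative lemma -/

open NumberField in
/-- **`ThetaInertAnnihilation` is false modulo `H = ExistsNonvanishingCodifferentInstance`**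
(refuted-misstated shape: the `qIndexSet` frame of `heckeT` versus the integral support of `Θ(c)`).
[folklore] -/
theorem thetaInertAnnihilation_false_of_existsNonvanishingCodifferentInstance :
    ExistsNonvanishingCodifferentInstance → ¬ ThetaInertAnnihilation := by
  intro hH hC
  apply hH
  intro F K _ _ _ _ _ σ a b hF hK hσ hc ha hb hneg hpos a' b' hdiv IsInt IsG δ φ₀ hδ hδ0 hφ sB V ip act
    G1 Stab Pos Gen Adm A _ _ IsTheta c hadd hcen f hf ϖ hϖ hpos' hinert hexcl hcodiff S hSsymm hSpos hndvd
  obtain ⟨e, -, hT⟩ := hC F K σ a b hF hK hσ hc ha hb hneg hpos hdiv δ φ₀ hδ hδ0 hφ A c hadd hcen f hf ϖ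
    hϖ hpos' hinert hexcl
  -- notation
  set S' : Matrix (Fin 2) (Fin 2) F := S.map (algebraMap (𝓞 F) F) with hS'
  have hϖ0 : (ϖ : F) ≠ 0 := RingOfIntegers.coe_ne_zero_iff.mpr hϖ.ne_zero
  have ha' : a' ∈ Set.range (algebraMap (𝓞 K) K) :=
    ⟨algebraMap (𝓞 F) (𝓞 K) a, by
      simp [a', ← IsScalarTower.algebraMap_apply]⟩
  have hb' : b' ∈ Set.range (algebraMap (𝓞 K) K) :=
    ⟨algebraMap (𝓞 F) (𝓞 K) b, by
      simp [b', ← IsScalarTower.algebraMap_apply]⟩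
  -- (1) `f` vanishes at totally positive matrices without admissible frames (the `m = 0` system)
  have hz : ∀ M : Matrix (Fin 2) (Fin 2) F, (∀ τ : F →+* ℝ, (M.map τ).PosDef) →
      (∀ x' : Fin 2 → QuaternionAlgebra K a' 0 b', ¬ Adm M x') → f M = 0 := by
    intro M hM hno
    have h0 := hf M hM 0 (fun k => Fin.elim0 k) (fun k => Fin.elim0 k)
      (fun x' hx' => (hno x' hx').elim) (fun k => Fin.elim0 k) (fun k => Fin.elim0 k)
    simpa using h0
  -- (2) an admissible frame forces integral entries
  have hint : ∀ (M : Matrix (Fin 2) (Fin 2) F) (x' : Fin 2 → QuaternionAlgebra K a' 0 b'), Adm M x' →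
      ∀ i j, M i j ∈ Set.range (algebraMap (𝓞 F) F) := by
    intro M x' hx' i j
    obtain ⟨hVI, hip⟩ := hx'
    apply mem_range_ringOfIntegers_of_algebraMap (K := K)
    rw [← hip i j]
    exact re_mul_star_mem_range ha' hb' (hVI i).2 (hVI j).2
  -- (3) the test matrix `T = ϖ⁻¹ S`
  set T : Matrix (Fin 2) (Fin 2) F := (ϖ : F)⁻¹ • S' with hTdef
  have hinvpos : ∀ τ : F →+* ℝ, 0 < τ (ϖ : F)⁻¹ := fun τ => by
    rw [map_inv₀]; exact inv_pos.mpr (hpos' τ)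
  have hTpos : ∀ τ : F →+* ℝ, (T.map τ).PosDef := fun τ => posDef_smul_map τ (hSpos τ) (hinvpos τ)
  have hSdet : S'.det = (S.det : F) := by
    rw [hS', RingOfIntegers.coe_eq_algebraMap S.det, RingHom.map_det, RingHom.mapMatrix_apply]
  have hTdet : T.det = (ϖ : F)⁻¹ ^ 2 * (S.det : F) := by
    rw [hTdef, Matrix.det_smul, Fintype.card_fin, hSdet]
  have hmem : T ∈ qIndexSet F := by
    refine ⟨(hSsymm.map _).smul _, ?_, fun τ => (hTpos τ).posSemidef⟩
    intro S₁ _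
    obtain ⟨n, hn⟩ := hcodiff (S * S₁).trace
    refine ⟨n, ?_⟩
    rw [← hn]
    congr 1
    rw [hTdef, Matrix.smul_mul, Matrix.trace_smul, smul_eq_mul, hS', ← Matrix.map_mul,
      ← AddMonoidHom.map_trace (algebraMap (𝓞 F) F) (S * S₁)]
  -- (4) the filed identity at `T`
  have key := hT T hTpos
  simp only [HilbertSiegel.heckeT] at key
  rw [heckeTWith_apply_of_mem (transversal ϖ) ϖ 2 (e : A) f hmem] at key
  -- (5) the four kinds of arguments
  have h1 : (ϖ : F) • T = S' := by
    rw [hTdef, smul_smul, mul_inv_cancel₀ hϖ0, one_smul]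
  have hdetInf : (heckeMatInf ϖ).det = (ϖ : F) := by
    simp [heckeMatInf, Matrix.det_fin_two_of]
  have hdetFin : ∀ j : 𝓞 F, (heckeMatFin ϖ j).det = (ϖ : F) := fun j => by
    simp [heckeMatFin, Matrix.det_fin_two_of]
  have htwist : ∀ D : Matrix (Fin 2) (Fin 2) F, D.det = (ϖ : F) →
      f ((ϖ : F)⁻¹ • (D * T * Dᵀ)) = 0 := by
    intro D hD
    refine hz _ (fun τ => posDef_twist τ D (hTpos τ) ?_ (hinvpos τ)) ?_
    · rw [hD]; exact (hpos' τ).ne'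
    · intro x' hx'
      obtain ⟨r, hr⟩ := exists_det_eq_coe (hint _ _ hx')
      rw [det_twist, hD, hTdet, ← mul_pow, inv_mul_cancel₀ hϖ0, one_pow, one_mul] at hr
      exact hndvd (sq_dvd_of_inv_sq_mul_eq hϖ0 hr)
  have hlast : f ((ϖ : F)⁻¹ • T) = 0 := by
    refine hz _ (fun τ => posDef_smul_map τ (hTpos τ) (hinvpos τ)) ?_
    intro x' hx'
    obtain ⟨r, hr⟩ := exists_det_eq_coe (hint _ _ hx')
    rw [Matrix.det_smul, Fintype.card_fin, hTdet] at hr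
    exact hndvd (sq_dvd_of_inv_sq_mul_inv_sq_mul_eq hϖ0 hr)
  rw [h1, htwist _ hdetInf, hlast, Finset.sum_eq_zero (fun j _ => htwist _ (hdetFin j))] at key
  simpa using key

end Summit.Langlands.Langlands.Theorems.ThetaInertAnnihilation.Negative
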